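import Summits.BirchSwinnertonDyer.BirchSwinnertonDyer.Theorems.ThetaPartnerAtTwoSignedControlAtTwoPlusGenGlueTwo
import Summits.BirchSwinnertonDyer.BirchSwinnertonDyer.Theorems.ThetaPartnerAtTwoSignedControlAtTwoPlusGenStepTwo
import HarnessLib

/-!
# The `ℤ₂`-LAYERS AT `2`, VI: the BRIDGE «coordinates in the plus field `ℚ₂(v_{n+2})`» ⟺ «`localLayerPointsOfEmb κ ι W n`» (the K4
# lead's `subfieldPoints … ℚ_[2]⟮v⟯` currency of `…PlusGenStepTwo` versus the stub's currency), and the GENERATOR CHANGE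
# `e ↦ d = 3•e − 2•c` for the (GEN) clause (K3 lead's normalisation `d_n = 3e_n − 2c_1` of the plus Honda points)
# (K4 `SignedControlAtTwo`, stmt-BirchSwinnertonDyer-20309, line `eulerchar` v6, stub `stub_plusHondaSystemTwo`, clause (GEN))

Route `ThetaPartnerAtTwo` (TP2; crux shared with `ResidualThetaTransportAtTwo`), crux K4, line `eulerchar` v6 (lead
`prover-bsd-wall-tp2-p3` g2); seat `prover-bsd-wall-tp2-p3-w2` (width seat 2/3, g2). Sequel of parts I–V.

WHY. The lead's generation step `SignedEC.PlusTower.exists_sub_closure_sub_two_smul_plus` (`…PlusGenStepTwo`, Kobayashi 8.11 ⇒ 8.12 along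
the plus tower at `2`, UNCONDITIONAL) is stated for points with COORDINATES in `k' = ℚ_[2]⟮v_{N+1}⟯`
(`subfieldPoints (genFibΩ 2 M) k'.toSubfield (coeffs_mem_adjoin M _)`), concludes `Λ(P − B − 2•R) ∈ k`, and uses a generator `e` with
`Λ e ≡ v_{N+1} (mod k)`. The stub `stub_plusHondaSystemTwo` speaks of `localLayerPointsOfEmb κ ι W n` and of ONE family `d` for all four
clauses; the K3 lead's family is `d_n = 3•e_n − 2•c_1` (exact trace relation), while `Λ e_n ≡ v_{n+2}`. This file supplies the two
conversions, so that «lead's log-level step + part IV's log descent (D1) + this bridge» is the (GEN) clause verbatim.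

WHAT (THEOREMS ONLY):
* §16 **`mem_localLayerPointsOfEmb_two_iff_mem_subfieldPoints_adjoin_v`** — for `hV : genFibΩ 2 M = W ⊗ ℚ̄₂`, cyclotomic `κ`, any `ι`:
  `P ∈ localLayerPointsOfEmb κ ι W n ⟺ (toLoc hV).symm P ∈ subfieldPoints (genFibΩ 2 M) (ℚ_[2]⟮v_{n+2}⟯)` — plus twin of O10's
  `forall_smul_eq_iff_mem_subfieldPoints` (coordinates in the `μ`-layer ⟺ fixed by `Stab ζ`), via part III's Galois correspondence.
  Corollary **`plusGen_kernel_two`**: the (GEN) clause of the stub at level `n ≥ 1` for `P ∈ E₁` with generator `toLoc e`, from the lead's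
  step + (D1), hypotheses = the lead's (`htr`, plus Honda point `e`) + `htors` (no `2`-power torsion in `L(n+2)`, K3).
* §17 **`plusGen_of_plusGen_generator_change`** (pure algebra, any group action): if the clause holds with generator `e` and `3•e = d + 2•c`
  with `c` in the (Γ-stable) lower subgroup, it holds with generator `d`; with part IV's `plusGen_of_plusGen_odd_nsmul` (odd saturation)
  this is all the algebra between the lead's/K3's outputs and clause (GEN).

HONEST FRAMING: THEOREMS ONLY (no definition, no named fact, no instance, no `sorry`), route-independent; closes no item; BSD is not proved
by any of this.

References: [Kobayashi2003] S. Kobayashi, Invent. Math. 152 (2003), Def. 1.1, §8.4 (Props. 8.7, 8.11, 8.12); [Washington1997] §13.1.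
-/

set_option autoImplicit false
-- the Theorems namespace of this sub repeats the summit name by design (D-0017 nested layout)
set_option linter.dupNamespace false

noncomputable section

open scoped Classical IntermediateField Topology NNReal

namespace Summit.BirchSwinnertonDyer.BirchSwinnertonDyer.Theorems.SignedEC.PlusLayer

open Field WeierstrassCurve Literature.NumberTheory.EllipticCurves Literature.NumberTheory.GaloisRepresentations
  Literature.NumberTheory.EllipticCurves.ZpExtension Literature.NumberTheory.EllipticCurves.Kobayashi2003
  Literature.NumberTheory.EllipticCurves.FormalGroupChart
  Summit.BirchSwinnertonDyer.Rank1Residual.Additive Summit.BirchSwinnertonDyer.Rank1Residual.Additive.PadicCyclotomicTower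
  Summit.BirchSwinnertonDyer.Rank1Residual.Additive.BallEval

/-! ## §16 Coordinates in `ℚ₂(v_{n+2})` ⟺ membership in `localLayerPointsOfEmb κ ι W n` -/

section Bridge

variable {M : WeierstrassCurve ℤ_[2]} [hE : (M.map PadicInt.Coe.ringHom).IsElliptic] [hEt : (M.map PadicInt.toZMod).IsElliptic]
  [hintΩ : (genFibΩ 2 M).IsIntegral (Valued.v (R := PadicAlgCl 2)).integer]
  {W : WeierstrassCurve ℚ} (hV : genFibΩ 2 M = W.baseChange (AlgebraicClosure ℚ_[2]))
  {κ : ZpExtension ℚ 2} (ι : AlgebraicClosure ℚ →ₐ[ℚ] PadicAlgCl 2)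

omit hE hEt hintΩ in
/-- **`E(ℚ_{2,n}·ℚ₂)`-membership is «coordinates in the plus field `ℚ₂(v_{n+2})`»**: a local point lies in
`localLayerPointsOfEmb κ ι W n` iff its preimage in `E_Ω` has coordinates in `ℚ_[2]⟮zeta 2 (n+2) + (zeta 2 (n+2))⁻¹ − 2⟯`
(part III: that field is the fixed field of `Gal(ℚ̄₂/ℚ_{2,n})`; the action is coordinatewise). [cite: Kobayashi2003, Def. 1.1, §8.4] -/
theorem mem_localLayerPointsOfEmb_two_iff_mem_subfieldPoints_adjoin_v (hκ : κ.IsCyclotomic) (n : ℕ) (P : localPoints W ℚ_[2]) :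
    P ∈ localLayerPointsOfEmb κ ι W n ↔
      (toLoc hV).symm P ∈ subfieldPoints (genFibΩ 2 M) (ℚ_[2]⟮zeta 2 (n + 2) + (zeta 2 (n + 2))⁻¹ - 2⟯).toSubfield
        (PlusTower.coeffs_mem_adjoin M _) := by
  obtain ⟨Q, rfl⟩ : ∃ Q, P = toLoc hV Q := ⟨(toLoc hV).symm P, ((toLoc hV).apply_symm_apply P).symm⟩
  rw [AddEquiv.symm_apply_apply, mem_localLayerPointsOfEmb_iff, ← adjoin_u_eq_adjoin_v]
  rcases Q with _ | ⟨x, y, hxy⟩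
  · simp only [show (Affine.Point.zero : (genFibΩ 2 M).toAffine.Point) = 0 from rfl, map_zero, smul_zero,
      implies_true, true_iff]
    exact (subfieldPoints _ _ _).zero_mem
  · rw [some_mem_subfieldPoints_iff]
    change _ ↔ x ∈ ℚ_[2]⟮zeta 2 (n + 2) + (zeta 2 (n + 2))⁻¹⟯ ∧ y ∈ ℚ_[2]⟮zeta 2 (n + 2) + (zeta 2 (n + 2))⁻¹⟯
    rw [mem_adjoin_u_iff_forall_mem_localLayerSubgroupOfEmb ι hκ n, mem_adjoin_u_iff_forall_mem_localLayerSubgroupOfEmb ι hκ n]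
    constructor
    · intro h
      have key : ∀ τ ∈ localLayerSubgroupOfEmb κ ι n, τ • x = x ∧ τ • y = y := by
        intro τ hτ
        obtain ⟨h', e⟩ := act_some hV τ x y hxy
        have h1 := h τ hτ
        rw [← (toLoc hV).symm.injective.eq_iff, e, AddEquiv.symm_apply_apply] at h1
        exact ⟨(Affine.Point.some.inj h1).1, (Affine.Point.some.inj h1).2⟩
      exact ⟨fun τ hτ ↦ (key τ hτ).1, fun τ hτ ↦ (key τ hτ).2⟩
    · rintro ⟨hx, hy⟩ τ hτ
      obtain ⟨h', e⟩ := act_some hV τ x y hxy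
      apply (toLoc hV).symm.injective
      rw [e, AddEquiv.symm_apply_apply]
      congr 1
      · exact hx τ hτ
      · exact hy τ hτ

/-- **The (GEN) clause of `stub_plusHondaSystemTwo` at level `n ≥ 1` on `E₁`, with generator `toLoc e`** — the K4 lead's UNCONDITIONAL
log-level step `PlusTower.exists_sub_closure_sub_two_smul_plus` (`N = n + 1`) + part IV's log descent (D1) + the bridge above. Hypotheses:
`a₂(M) = 0` (`htr`), a plus Honda point `e ∈ E₁(ℚ₂(v_{n+2}))` with `Λ e ≡ v_{n+2} (mod ℚ₂(v_{n+1}))`, no `2`-power torsion in `L(n+2)`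
(`htors`, Kobayashi Prop. 8.7 at `2`, K3 lead's `eq_zero_of_two_pow_smul_eq_zero_of_mem_subfieldPoints_layer`). For every `P ∈ E₁` with
`toLoc P ∈ E(ℚ_{2,n}·ℚ₂)`: `toLoc P = B + P' + 2•R`, `B ∈ ℤ[Γ_{ℚ₂}]·toLoc e`, `P' ∈ E(ℚ_{2,n−1}·ℚ₂)`, `R ∈ E(ℚ_{2,n}·ℚ₂)`.
[cite: Kobayashi2003, Prop. 8.11, Prop. 8.12] -/
theorem plusGen_kernel_two (hκ : κ.IsCyclotomic)
    (htr : Literature.NumberTheory.EllipticCurves.HasseManin.tr (M.map PadicInt.toZMod) = 0) {n : ℕ} (hn : 1 ≤ n)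
    (htors : ∀ Q ∈ subfieldPoints (genFibΩ 2 M) (layer 2 (n + 2)).toSubfield coeffs_mem_layer,
      ∀ k : ℕ, 2 ^ k • Q = 0 → Q = 0)
    {e : (genFibΩ 2 M).toAffine.Point}
    (heL : e ∈ subfieldPoints (genFibΩ 2 M) (ℚ_[2]⟮zeta 2 (n + 2) + (zeta 2 (n + 2))⁻¹ - 2⟯).toSubfield
      (PlusTower.coeffs_mem_adjoin M _))
    (hek : e ∈ kernel (Valued.v (R := PadicAlgCl 2)) (genFibΩ 2 M))
    (heℓ : ptLogΩ 2 M e - (zeta 2 (n + 2) + (zeta 2 (n + 2))⁻¹ - 2) ∈ ℚ_[2]⟮zeta 2 (n + 1) + (zeta 2 (n + 1))⁻¹ - 2⟯)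
    {P : (genFibΩ 2 M).toAffine.Point} (hPk : P ∈ kernel (Valued.v (R := PadicAlgCl 2)) (genFibΩ 2 M))
    (hPn : toLoc hV P ∈ localLayerPointsOfEmb κ ι W n) :
    ∃ B ∈ AddSubgroup.closure (Set.range fun σ : absoluteGaloisGroup ℚ_[2] ↦ σ • toLoc hV e),
      ∃ P' ∈ localLayerPointsOfEmb κ ι W (n - 1), ∃ R ∈ localLayerPointsOfEmb κ ι W n,
        toLoc hV P = B + P' + 2 • R := by
  obtain ⟨n', rfl⟩ := Nat.exists_eq_add_of_le' hn
  -- `P` has coordinates in the plus field `k' = ℚ₂(v_{n+2})`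
  have hPL' := (mem_localLayerPointsOfEmb_two_iff_mem_subfieldPoints_adjoin_v hV ι hκ (n' + 1) (toLoc hV P)).mp hPn
  rw [AddEquiv.symm_apply_apply] at hPL'
  obtain ⟨B, hB, R, hRL, hRk, hDL, hDk, hDℓ⟩ := PlusTower.exists_sub_closure_sub_two_smul_plus (M := M) htr
    (fun σ Q ↦ (toLoc hV).symm (σ • toLoc hV Q)) (act_zero hV) (act_some hV) (N := n' + 2) (by omega)
    (by simpa using heL) hek (by simpa using heℓ) (by simpa using hPL') hPk
  -- descent of `P − B − 2•R` to layer `n − 1 = n'` (part IV (D1)), via coordinates in `ℚ₂(ζ_{2^{n+2}})`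
  have hle : ℚ_[2]⟮zeta 2 (n' + 2 + 1) + (zeta 2 (n' + 2 + 1))⁻¹ - 2⟯ ≤ layer 2 (n' + 1 + 2) := by
    rw [show n' + 2 + 1 = n' + 1 + 2 by ring]; exact PlusTower.adjoin_v_le_layer _
  have hDL2 : P - B - 2 • R ∈ subfieldPoints (genFibΩ 2 M) (layer 2 (n' + 1 + 2)).toSubfield coeffs_mem_layer :=
    PlusTower.mem_subfieldPoints_of_le _ _ hle hDL
  have hRL2 : R ∈ subfieldPoints (genFibΩ 2 M) (layer 2 (n' + 1 + 2)).toSubfield coeffs_mem_layer :=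
    PlusTower.mem_subfieldPoints_of_le _ _ hle hRL
  have hDℓ' : ptLogΩ 2 M (P - B - 2 • R) ∈ ℚ_[2]⟮zeta 2 (n' + 2) + (zeta 2 (n' + 2))⁻¹⟯ := by
    rw [adjoin_u_eq_adjoin_v]; exact hDℓ
  have hdesc : toLoc hV (P - B - 2 • R) ∈ localLayerPointsOfEmb κ ι W n' :=
    toLoc_mem_localLayerPointsOfEmb_of_ptLogΩ_mem hV ι hκ htors hDL2 hDk hDℓ'
  -- `R ∈ E(k')`: its coordinates lie in the plus field
  have hRn : toLoc hV R ∈ localLayerPointsOfEmb κ ι W (n' + 1) := by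
    rw [mem_localLayerPointsOfEmb_two_iff_mem_subfieldPoints_adjoin_v hV ι hκ (n' + 1), AddEquiv.symm_apply_apply]
    simpa using hRL
  refine ⟨toLoc hV B, ?_, toLoc hV (P - B - 2 • R), by simpa using hdesc, toLoc hV R, hRn, ?_⟩
  · rw [← map_closure_range_act_eq hV e]
    exact ⟨B, hB, rfl⟩
  · simp only [map_sub, map_nsmul]
    abel

end Bridge

/-! ## §17 Generator change `e ↦ d` with `3•e = d + 2•c` -/

section GeneratorChange

variable {G : Type*} [Group G] {A : Type*} [AddCommGroup A] [DistribMulAction G A]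

/-- **Generator change for the (GEN) clause.** If every `P ∈ H` is `B + P' + 2•R` with `B ∈ ℤ[G·e]`, `P' ∈ H'`, `R ∈ H`, and
`3•e = d + 2•c` with `c ∈ H'`, `H'` stable under `G`, then every `P ∈ H` is `B + P' + 2•R` with `B ∈ ℤ[G·d]` (`3B ∈ ℤ[G·d] + 2H'`,
`P = 3P − 2P`). For K4: `e = e_n`, `d = d_n = 3e_n − 2c_1` (K3 lead's exact-trace normalisation), `c = c_1 ∈ E(ℚ₂) ⊆ E(ℚ_{2,n−1}·ℚ₂)`.
[cite: Kobayashi2003, Prop. 8.12] -/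
theorem plusGen_of_plusGen_generator_change {H H' : AddSubgroup A} (hH' : ∀ (g : G) {x : A}, x ∈ H' → g • x ∈ H')
    {e d c : A} (hedc : 3 • e = d + 2 • c) (hc : c ∈ H') {P : A} (hP : P ∈ H)
    (h : ∃ B ∈ AddSubgroup.closure (Set.range fun g : G ↦ g • e), ∃ P' ∈ H', ∃ R ∈ H, P = B + P' + 2 • R) :
    ∃ B ∈ AddSubgroup.closure (Set.range fun g : G ↦ g • d), ∃ P' ∈ H', ∃ R ∈ H, P = B + P' + 2 • R := by
  obtain ⟨B, hB, P', hP', R, hR, hPe⟩ := h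
  -- `3 • B = Bd + 2 • C` with `Bd ∈ ℤ[G·d]`, `C ∈ H'`
  have key : ∀ B₀ ∈ AddSubgroup.closure (Set.range fun g : G ↦ g • e),
      ∃ Bd ∈ AddSubgroup.closure (Set.range fun g : G ↦ g • d), ∃ C ∈ H', 3 • B₀ = Bd + 2 • C := by
    intro B₀ hB₀
    induction hB₀ using AddSubgroup.closure_induction with
    | mem x hx =>
      obtain ⟨g, rfl⟩ := hx
      refine ⟨g • d, AddSubgroup.subset_closure ⟨g, rfl⟩, g • c, hH' g hc, ?_⟩
      have h3 : g • (3 • e) = 3 • (g • e) := map_nsmul (DistribSMul.toAddMonoidHom A g) 3 e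
      have h2 : g • (2 • c) = 2 • (g • c) := map_nsmul (DistribSMul.toAddMonoidHom A g) 2 c
      change 3 • (g • e) = g • d + 2 • (g • c)
      rw [← h3, hedc, smul_add, h2]
    | zero => exact ⟨0, AddSubgroup.zero_mem _, 0, H'.zero_mem, by simp⟩
    | add x y _ _ ihx ihy =>
      obtain ⟨B₁, hB₁, C₁, hC₁, h₁⟩ := ihx
      obtain ⟨B₂, hB₂, C₂, hC₂, h₂⟩ := ihy
      refine ⟨B₁ + B₂, AddSubgroup.add_mem _ hB₁ hB₂, C₁ + C₂, H'.add_mem hC₁ hC₂, ?_⟩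
      rw [nsmul_add, h₁, h₂, nsmul_add]; abel
    | neg x _ ih =>
      obtain ⟨B₁, hB₁, C₁, hC₁, h₁⟩ := ih
      refine ⟨-B₁, AddSubgroup.neg_mem _ hB₁, -C₁, H'.neg_mem hC₁, ?_⟩
      rw [smul_neg, h₁, smul_neg]; abel
  obtain ⟨Bd, hBd, C, hC, h3B⟩ := key B hB
  refine ⟨Bd, hBd, 2 • C + 3 • P', H'.add_mem (H'.nsmul_mem hC 2) (H'.nsmul_mem hP' 3), 3 • R - P,
    H.sub_mem (H.nsmul_mem hR 3) hP, ?_⟩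
  have h3P : 3 • P = 3 • B + 3 • P' + 6 • R := by
    rw [hPe, nsmul_add, nsmul_add, ← mul_nsmul]
  have hPP : 3 • P - 2 • P = P := by
    rw [show (3 : ℕ) = 2 + 1 from rfl, add_nsmul, one_nsmul, add_sub_cancel_left]
  calc P = 3 • P - 2 • P := hPP.symm
    _ = Bd + 2 • C + 3 • P' + 6 • R - 2 • P := by rw [h3P, h3B]
    _ = Bd + (2 • C + 3 • P') + 2 • (3 • R - P) := by
        rw [nsmul_sub, show (6 : ℕ) = 2 * 3 from rfl, mul_nsmul]; abel

end GeneratorChange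

end Summit.BirchSwinnertonDyer.BirchSwinnertonDyer.Theorems.SignedEC.PlusLayer

end
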